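import Literature.NumberTheory.LFunctions.Zhang2022.Section8Lemma84ContourBound
import Literature.NumberTheory.LFunctions.Zhang2022.Section8Lemma84PhiBounds
import Literature.NumberTheory.LFunctions.Zhang2022.Section5Lemma58
import Literature.NumberTheory.LFunctions.Zhang2022.Section10RangeToolkit
import Literature.NumberTheory.LFunctions.Zhang2022.SkeletonWindowPowers
import HarnessLib

/-!
# Zhang (2022), Lemma 8.4 — X: the contour argument for the manuscript's objects, explicit pieces

Topic `Literature/NumberTheory/LFunctions/Zhang2022` (Landau–Siegel audit tree; verdict-neutral).
Y. Zhang, *Discrete mean estimates and the Landau–Siegel zero*, arXiv:2211.02515v1 (2022)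
[Zhang2022LandauSiegel] — **an unrefereed manuscript under adjudication**; DAG nodes `Z22:Lem8.4`,
`Z22:Lem8.4.pf`, `Z22:(8.9)` [Z22 p.46–47, tex L2392–2418].

This file instantiates the generic contour inequality `Lemma84.norm_sum_log_sub_main_le` with the
manuscript's objects: the coefficients `χ(n)ξ₀ⱼ(n;d,r)n^{β_μ−1}` (file `Section8Lemma84Coeff`), the
continuation `𝔲 = U` of Lemma 8.3 (ANY function with the three properties of the banked
`Skeleton.Lemma83Rel`, taken as hypotheses), the shifts `β_{j+1}, β_{j+2}, β_μ`, the exceptional zero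
`ρ̃` with the zero-free package of MV Thm 11.4, and Lemma 5.8 (tree theorem `Lemma58.lemma_5_8_of_le`)
on the small rectangle. Output (`lemma84_core`): for `T < y < P`,
`‖Σ_{n<y} χ(n)ξ₀ⱼ(n;d,r)n⁻¹(y/n)^{−β_μ}log(y/n) − L′(1,χ)Π(d,r)𝔤_{jμ}(y)‖ ≤` an explicit sum of four
pieces (tails, left side, horizontal sides, small rectangle) in terms of the bounds `M_U`, `B_L`,
`M_inv` and the relative error `C₈₃𝓛⁻⁸∏_{q∣dr}(1−q⁻¹)⁻¹` of `𝔲 − Π(d,r)`; the small-rectangle piece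
carries `‖Π(d,r)‖ ≤ (∏_{q∣dr}(1−q⁻¹)⁻¹)²` (`norm_Phi_sub_model_le`) — the source of the relative
constant in `Skeleton.Lemma84Rel` (gap rows G-adj1-1, G-d55-3).

Nothing about the manuscript's Theorems 1–2 or about Landau–Siegel zeros is asserted.

## References

* Y. Zhang, arXiv:2211.02515v1 (2022), §8 Lemma 8.4 (statement and proof), Lemma 8.3, (8.9),
  §5 Lemmas 5.5, 5.8. [cite: Zhang2022LandauSiegel, §8 Lemma 8.4]
* H. L. Montgomery, R. C. Vaughan, *Multiplicative Number Theory I*, CUP 2007, §6.2, Thm 11.4.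
  [cite: MontgomeryVaughan2007, Thm 11.4]
-/

noncomputable section

open Complex Real Set Finset

namespace Literature.NumberTheory.LFunctions.Zhang2022.Lemma84

open Skeleton Literature.Analysis.Complex

section Estimate

variable {D : ℕ} [NeZero D] (χ : DirichletCharacter ℂ D) (c' : ℝ)

omit [NeZero D] in
/-- `‖Π(d,r)‖ ≤ (∏_{q∣dr}(1 − q⁻¹)⁻¹)²` (the tree's `Skeleton.norm_PiW_le`, `dr/φ(dr) = ∏_{q∣dr} q/(q−1)`).
[cite: Zhang2022LandauSiegel, §8 Lemma 8.3] -/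
theorem norm_PiW_le_prodInv {d r : ℕ} (hd : d ≠ 0) (hr : r ≠ 0) :
    ‖PiW χ d r‖ ≤ (∏ q ∈ (d * r).primeFactors, (1 - (q : ℝ)⁻¹)⁻¹) ^ 2 := by
  have h := norm_PiW_le χ hd hr
  rw [self_div_totient_eq_prod (mul_ne_zero hd hr)] at h
  refine h.trans (le_of_eq ?_)
  congr 1
  refine Finset.prod_congr rfl fun q hq => ?_
  have hq : (1 : ℝ) < q := by exact_mod_cast (Nat.prime_of_mem_primeFactors hq).one_lt
  have hq0 : (q : ℝ) ≠ 0 := by linarith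
  have hq1 : (q : ℝ) - 1 ≠ 0 := by linarith
  field_simp

/-- `α = π𝓛⁻⁹`. [cite: Zhang2022LandauSiegel, §2 (2.6), (2.10)] -/
theorem alpha_eq (D : ℕ) : alpha D = π / Real.log D ^ 9 := by
  rw [alpha, bigP, Real.log_exp, ell]

/-- On the boundary of the small rectangle, with `s = u − β_μ`: `α/2 ≤ |s| ≤ 7α/2`, `Re s = Re u`.
[cite: Zhang2022LandauSiegel, §8 Lemma 8.4 (proof)] -/
theorem small_rect_s_bounds {α : ℝ} (hα : 0 < α) {βμ u : ℂ} (hβμ : βμ.re = 0)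
    (hre : u.re ∈ Icc (-(α / 2)) (α / 2)) (him : u.im ∈ Icc (βμ.im - 3 * α) (βμ.im + 3 * α))
    (hbd : |u.re| = α / 2 ∨ |u.im - βμ.im| = 3 * α) :
    α / 2 ≤ ‖u - βμ‖ ∧ ‖u - βμ‖ ≤ 7 * α / 2 := by
  have hsre : (u - βμ).re = u.re := by simp [hβμ]
  have hsim : (u - βμ).im = u.im - βμ.im := by simp
  constructor
  · rcases hbd with h | h
    · calc α / 2 = |(u - βμ).re| := by rw [hsre, h]
        _ ≤ ‖u - βμ‖ := Complex.abs_re_le_norm _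
    · have : α / 2 ≤ |(u - βμ).im| := by rw [hsim, h]; linarith
      exact this.trans (Complex.abs_im_le_norm _)
  · calc ‖u - βμ‖ ≤ |(u - βμ).re| + |(u - βμ).im| := Complex.norm_le_abs_re_add_abs_im _
      _ ≤ α / 2 + 3 * α := by
          rw [hsre, hsim]
          gcongr
          · exact abs_le.2 ⟨by linarith [hre.1], hre.2⟩
          · exact abs_le.2 ⟨by linarith [him.1], by linarith [him.2]⟩
      _ = 7 * α / 2 := by ring

/-- **The model comparison on the small rectangle for the manuscript's integrand.** Let `χ` be
primitive mod `D`, `𝓛 = log D ≥ 3`, (A) `‖L(1,χ)‖ ≤ 𝓛⁻²⁰²²`, `K ≥ 7 + 15|c′|` with `Kπ ≤ 𝓛⁸`,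
`0 < ℓ₀ ≤ |L′(1,χ)|` with `(1 + 16e^{9/2}π²K²)𝓛⁻¹⁵ ≤ ℓ₀α/4`, and `U` with
`‖U(w) − Π(d,r)‖ ≤ C₈₃𝓛⁻⁸Π̂` for `|w − 1| ≤ 5α` (`Π̂ = ∏_{q∣dr}(1−q⁻¹)⁻¹`, Lemma 8.3 (iii′)). Then at
every boundary point `u` of `R_s`, with `Φ(u) = U(w)L(w+β_{j+1})L(w+β_{j+2})/L(w)`,
`w = 1 − β_μ + u`:
`‖Φ(u) − L′(1,χ)Π(d,r)(u+β_{j+1}−β_μ)(u+β_{j+2}−β_μ)/(u−β_μ)‖ ≤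
  Π̂²(1+16e^{9/2}π²K²)𝓛⁻¹⁵(24K²+2K) + 32K³(C₈₃𝓛⁻⁸Π̂)(2e^{9/2}(1+𝓛)𝓛)α`
(Lemma 5.8 for the three `L`-values, `Lemma84.norm_quot_sub_model_le`, `‖Π‖ ≤ Π̂²`).
[cite: Zhang2022LandauSiegel, §8 Lemma 8.4 (proof, "By Lemma 5.5 and 5.6 … O(𝓛⁻¹⁵)")] -/
theorem norm_Phi_sub_model_le (hprim : χ.IsPrimitive) (h𝓛 : 3 ≤ Real.log D)
    (hA : ‖χ.LFunction 1‖ ≤ 1 / Real.log D ^ 2022) (j μ : ℕ) {d r : ℕ} (hd : d ≠ 0) (hr : r ≠ 0)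
    (U : ℂ → ℂ) {C₈₃ K ℓ₀ : ℝ} (hC₈₃ : 0 ≤ C₈₃) (hK : 7 + 15 * |c'| ≤ K)
    (hKL : K * π ≤ Real.log D ^ 8) (hℓ₀ : 0 < ℓ₀) (hℓ : ℓ₀ ≤ ‖deriv χ.LFunction 1‖)
    (hE : (1 + 16 * Real.exp (9 / 2) * π ^ 2 * K ^ 2) / Real.log D ^ 15 ≤ ℓ₀ * alpha D / 4)
    (hU3 : ∀ s : ℂ, ‖s - 1‖ ≤ 5 * alpha D → ‖U s - PiW χ d r‖ ≤
      C₈₃ * (ell D ^ 8)⁻¹ * ∏ q ∈ (d * r).primeFactors, (1 - (q : ℝ)⁻¹)⁻¹)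
    {u : ℂ} (hre : u.re ∈ Icc (-(alpha D / 2)) (alpha D / 2))
    (him : u.im ∈ Icc ((betaMu D μ).im - 3 * alpha D) ((betaMu D μ).im + 3 * alpha D))
    (hbd : |u.re| = alpha D / 2 ∨ |u.im - (betaMu D μ).im| = 3 * alpha D) :
    ‖U (1 - betaMu D μ + u) * χ.LFunction (1 - betaMu D μ + u + betaJ c' D (j + 1)) *
          χ.LFunction (1 - betaMu D μ + u + betaJ c' D (j + 2)) / χ.LFunction (1 - betaMu D μ + u) -
        deriv χ.LFunction 1 * PiW χ d r * (u + (betaJ c' D (j + 1) - betaMu D μ)) *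
          (u + (betaJ c' D (j + 2) - betaMu D μ)) / (u - betaMu D μ)‖ ≤
      (∏ q ∈ (d * r).primeFactors, (1 - (q : ℝ)⁻¹)⁻¹) ^ 2 *
          ((1 + 16 * Real.exp (9 / 2) * π ^ 2 * K ^ 2) / Real.log D ^ 15) * (24 * K ^ 2 + 2 * K) +
        32 * K ^ 3 * (C₈₃ * (ell D ^ 8)⁻¹ * ∏ q ∈ (d * r).primeFactors, (1 - (q : ℝ)⁻¹)⁻¹) *
          (2 * Real.exp (9 / 2) * (1 + Real.log D) * Real.log D) * alpha D := by
  set 𝓛 : ℝ := Real.log D with h𝓛def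
  set α : ℝ := alpha D with hαdef
  set βμ : ℂ := betaMu D μ with hβμdef
  set βa : ℂ := betaJ c' D (j + 1) with hβadef
  set βb : ℂ := betaJ c' D (j + 2) with hβbdef
  set hatPi : ℝ := ∏ q ∈ (d * r).primeFactors, (1 - (q : ℝ)⁻¹)⁻¹ with hhatPi
  set E : ℝ := (1 + 16 * Real.exp (9 / 2) * π ^ 2 * K ^ 2) / 𝓛 ^ 15 with hEdef
  set ℓ : ℂ := deriv χ.LFunction 1 with hℓdef
  have hℓ1 : 1 ≤ ell D := by rw [ell]; linarith
  have hℓ2 : 2 ≤ ell D := by rw [ell]; linarith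
  have hα0 : 0 < α := alpha_pos' (by linarith)
  have hαeq : α = π / 𝓛 ^ 9 := alpha_eq D
  have hαℓ : α * ell D ≤ 1 := alpha_mul_ell_le_one hℓ2
  have hK1 : 1 ≤ K := by linarith [abs_nonneg c']
  have hβμre : βμ.re = 0 := betaMu_re D μ
  -- the variable `s = u − β_μ`
  set s : ℂ := u - βμ with hsdef
  obtain ⟨hs_lo, hs_hi⟩ := small_rect_s_bounds hα0 hβμre hre him hbd
  have h1s : 1 - βμ + u = 1 + s := by rw [hsdef]; ring
  have hAeq : u + (βa - βμ) = s + βa := by rw [hsdef]; ring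
  have hBeq : u + (βb - βμ) = s + βb := by rw [hsdef]; ring
  -- sizes of the shifts
  have hβ : ∀ i : ℕ, ‖betaJ c' D i‖ ≤ 3 * α * (1 + 5 * |c'|) := by
    intro i
    have h := norm_betaJ_le c' D i hα0.le (by linarith : 0 ≤ ell D)
    refine h.trans ?_
    have : 5 * |c'| * alpha D * ell D ≤ 5 * |c'| := by
      calc 5 * |c'| * alpha D * ell D = 5 * |c'| * (alpha D * ell D) := by ring
        _ ≤ 5 * |c'| * 1 := by gcongr
        _ = 5 * |c'| := mul_one _
    rw [← hαdef] at this ⊢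
    nlinarith [abs_nonneg c']
  have hsK : ‖s‖ ≤ K * α := by nlinarith [abs_nonneg c']
  have hAK : ‖s + βa‖ ≤ K * α := by
    calc ‖s + βa‖ ≤ ‖s‖ + ‖βa‖ := norm_add_le _ _
      _ ≤ 7 * α / 2 + 3 * α * (1 + 5 * |c'|) := add_le_add hs_hi (hβ _)
      _ ≤ K * α := by nlinarith [abs_nonneg c']
  have hBK : ‖s + βb‖ ≤ K * α := by
    calc ‖s + βb‖ ≤ ‖s‖ + ‖βb‖ := norm_add_le _ _
      _ ≤ 7 * α / 2 + 3 * α * (1 + 5 * |c'|) := add_le_add hs_hi (hβ _)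
      _ ≤ K * α := by nlinarith [abs_nonneg c']
  -- Lemma 5.8 at the three points
  have h58 : ∀ z : ℂ, ‖z‖ ≤ K * α → ‖χ.LFunction (1 + z) - ℓ * z‖ ≤ E := by
    intro z hz
    have hz' : ‖(1 + z) - 1‖ ≤ K * π / Real.log D ^ 9 := by
      rw [add_sub_cancel_left, ← h𝓛def]
      calc ‖z‖ ≤ K * α := hz
        _ = K * π / 𝓛 ^ 9 := by rw [hαeq]; ring
    have h := Lemma58.lemma_5_8_of_le χ hprim h𝓛 hA hKL hz'
    rw [add_sub_cancel_left] at h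
    exact h
  have ha : ‖χ.LFunction (1 + s + βa) - ℓ * (s + βa)‖ ≤ E := by
    rw [add_assoc]; exact h58 _ hAK
  have hb : ‖χ.LFunction (1 + s + βb) - ℓ * (s + βb)‖ ≤ E := by
    rw [add_assoc]; exact h58 _ hBK
  have h0 : ‖χ.LFunction (1 + s) - ℓ * s‖ ≤ E := h58 _ hsK
  -- Lemma 8.3 (iii′) at `1 + s`
  have hu : ‖U (1 + s) - PiW χ d r‖ ≤ C₈₃ * (ell D ^ 8)⁻¹ * hatPi :=
    hU3 _ (by rw [add_sub_cancel_left]; linarith)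
  have hE0 : 0 ≤ E := by positivity
  have hEU0 : 0 ≤ C₈₃ * (ell D ^ 8)⁻¹ * hatPi := by
    have h0 : 0 ≤ hatPi := Finset.prod_nonneg fun q hq => by
      have hq2 : (2 : ℝ) ≤ q := by exact_mod_cast (Nat.prime_of_mem_primeFactors hq).two_le
      have : (q : ℝ)⁻¹ ≤ 1 / 2 := by rw [inv_eq_one_div]; gcongr
      exact inv_nonneg.2 (by linarith)
    positivity
  have hEℓ : E ≤ ℓ₀ * α / 4 := hE
  -- the algebraic comparison
  have hcmp := norm_quot_sub_model_le (u := U (1 + s)) (La := χ.LFunction (1 + s + βa))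
    (Lb := χ.LFunction (1 + s + βb)) (L0 := χ.LFunction (1 + s)) (Pv := PiW χ d r) (ℓ := ℓ)
    (s := s) (A := s + βa) (B := s + βb) hα0 hK1 hℓ₀ hℓ hE0 hEU0 hEℓ ha hb h0 hu hs_lo hsK hAK hBK
  have heq : U (1 - βμ + u) * χ.LFunction (1 - βμ + u + βa) * χ.LFunction (1 - βμ + u + βb) /
        χ.LFunction (1 - βμ + u) -
      ℓ * PiW χ d r * (u + (βa - βμ)) * (u + (βb - βμ)) / (u - βμ) =
      U (1 + s) * χ.LFunction (1 + s + βa) * χ.LFunction (1 + s + βb) / χ.LFunction (1 + s) -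
        PiW χ d r * ℓ * (s + βa) * (s + βb) / s := by
    rw [h1s, hAeq, hBeq]; ring
  rw [heq]
  refine hcmp.trans ?_
  -- `‖Π‖ ≤ Π̂²`, `‖ℓ‖ ≤ 2e^{9/2}(1+𝓛)𝓛`
  have hPi : ‖PiW χ d r‖ ≤ hatPi ^ 2 := norm_PiW_le_prodInv χ hd hr
  have hℓle : ‖ℓ‖ ≤ 2 * Real.exp (9 / 2) * (1 + 𝓛) * 𝓛 :=
    Lemma31.norm_deriv_LFunction_le_near_one χ h𝓛 hprim (w := 1)
      (by rw [sub_self, norm_zero]; positivity)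
  have hK0 : 0 ≤ 24 * K ^ 2 + 2 * K := by positivity
  gcongr

/-- **Lemma 8.4 for the manuscript's objects, with the four error pieces explicit.** Hypotheses:
`χ ≠ χ₀` primitive mod `D`, `𝓛 = log D ≥ 3`, (A) `‖L(1,χ)‖ ≤ 𝓛⁻²⁰²²`; `T < y < P`, `d, r ≥ 1`,
`dr < PT⁻²`; `U` holomorphic on `σ > 9/10` with `U = L/(L_aL_b)·Σχξ₀ⱼn^{−s}` for `σ > 1`,
`‖U‖ ≤ M_U` on `σ ≥ 1 − η`, `‖U − Π(d,r)‖ ≤ C₈₃𝓛⁻⁸Π̂` on `|s−1| ≤ 5α` (`T < y`; the bound `y < P` is not needed here); `0 < α ≤ η ≤ 1/40`;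
`‖L(s,χ)‖ ≤ B_L` for `σ ≥ 1 − η`, `|s| ≤ D + 4`; the zero-free package with constant `M_inv` on
`σ ≥ 1 − 2η`, `|t| ≤ D + 1` around the exceptional zero `ρ ∈ [1 − η/2, 1)`, `ρ > 1 − α/2`,
`L(ρ,χ) = 0 ≠ L′(ρ,χ)`; `0 < ℓ₀ ≤ |L′(1,χ)|`; `K ≥ 7 + 15|c′|`, `Kπ ≤ 𝓛⁸`,
`(1+16e^{9/2}π²K²)𝓛⁻¹⁵ ≤ ℓ₀α/4`. Conclusion: the printed difference of Lemma 8.4 is at most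
`(2π)⁻¹(2e^{αL}M_U((1+α)/α)³/D + e^{−ηL}M_UB_L²M_inv(1+2/η)π/η + 2(α+η)e^{αL}·3M_UB_L²M_inv/D²
  + 56e^{αL/2}Δ/α)`, `L = log y`, `Δ` as in `norm_Phi_sub_model_le`.
[cite: Zhang2022LandauSiegel, §8 Lemma 8.4] [cite: MontgomeryVaughan2007, §6.2, Thm 11.4] -/
theorem lemma84_core (hχ1 : χ ≠ 1) (hprim : χ.IsPrimitive) (h𝓛 : 3 ≤ Real.log D)
    (hA : ‖χ.LFunction 1‖ ≤ 1 / Real.log D ^ 2022) (j μ : ℕ) {d r : ℕ} (hd : d ≠ 0) (hr : r ≠ 0)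
    {y : ℝ} (hy1 : bigT D < y) (U : ℂ → ℂ)
    {ρ η MU BL Minv C₈₃ K ℓ₀ : ℝ}
    (hUd : DifferentiableOn ℂ U {s : ℂ | 9 / 10 < s.re})
    (hU1 : ∀ s : ℂ, 1 < s.re → U s = χ.LFunction s /
      (χ.LFunction (s + betaJ c' D (j + 1)) * χ.LFunction (s + betaJ c' D (j + 2))) *
        xiSeries c' χ j d r s)
    (hMU : 0 ≤ MU) (hU : ∀ w : ℂ, 1 - η ≤ w.re → ‖U w‖ ≤ MU) (hC₈₃ : 0 ≤ C₈₃)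
    (hU3 : ∀ s : ℂ, ‖s - 1‖ ≤ 5 * alpha D → ‖U s - PiW χ d r‖ ≤
      C₈₃ * (ell D ^ 8)⁻¹ * ∏ q ∈ (d * r).primeFactors, (1 - (q : ℝ)⁻¹)⁻¹)
    (hαη : alpha D ≤ η) (hη40 : η ≤ 1 / 40) (hBL : 0 ≤ BL)
    (hL : ∀ s : ℂ, 1 - η ≤ s.re → ‖s‖ ≤ (D : ℝ) + 4 → ‖χ.LFunction s‖ ≤ BL) (hMinv : 0 ≤ Minv)
    (hpack : ∀ s : ℂ, 1 - 2 * η ≤ s.re → |s.im| ≤ (D : ℝ) + 1 → s ≠ (ρ : ℂ) →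
      χ.LFunction s ≠ 0 ∧ ‖(χ.LFunction s)⁻¹‖ ≤ Minv * (1 + ‖s - ρ‖⁻¹))
    (hρ1 : ρ < 1) (hρη : 1 - η / 2 ≤ ρ) (hρα : 1 - alpha D / 2 < ρ) (hLρ : χ.LFunction ρ = 0)
    (hL'ρ : deriv χ.LFunction ρ ≠ 0) (hℓ₀ : 0 < ℓ₀) (hℓ : ℓ₀ ≤ ‖deriv χ.LFunction 1‖)
    (hK : 7 + 15 * |c'| ≤ K) (hKL : K * π ≤ Real.log D ^ 8)
    (hE : (1 + 16 * Real.exp (9 / 2) * π ^ 2 * K ^ 2) / Real.log D ^ 15 ≤ ℓ₀ * alpha D / 4) :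
    ‖(∑ n ∈ Finset.Ico 1 ⌈y⌉₊, χ (n : ZMod D) * xiZero c' D j n d r / (n : ℂ) *
          ((y / n : ℝ) : ℂ) ^ (-betaMu D μ) * (Real.log (y / n) : ℂ)) -
        deriv χ.LFunction 1 * PiW χ d r * frakgW c' D j μ y‖ ≤
      1 / (2 * π) * (2 * (Real.exp (alpha D * Real.log y) * (MU * ((1 + alpha D) / alpha D) ^ 3) / D) +
        Real.exp (-η * Real.log y) * (MU * BL * BL * (Minv * (1 + 2 / η))) * (π / η) +
        2 * ((alpha D + η) * (Real.exp (alpha D * Real.log y) * (MU * BL * BL * (Minv * 3)) /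
          (D : ℝ) ^ 2)) +
        56 * Real.exp (alpha D * Real.log y / 2) *
          ((∏ q ∈ (d * r).primeFactors, (1 - (q : ℝ)⁻¹)⁻¹) ^ 2 *
              ((1 + 16 * Real.exp (9 / 2) * π ^ 2 * K ^ 2) / Real.log D ^ 15) * (24 * K ^ 2 + 2 * K) +
            32 * K ^ 3 * (C₈₃ * (ell D ^ 8)⁻¹ * ∏ q ∈ (d * r).primeFactors, (1 - (q : ℝ)⁻¹)⁻¹) *
              (2 * Real.exp (9 / 2) * (1 + Real.log D) * Real.log D) * alpha D) / alpha D) := by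
  set α : ℝ := alpha D with hαdef
  set βμ : ℂ := betaMu D μ with hβμdef
  set βa : ℂ := betaJ c' D (j + 1) with hβadef
  set βb : ℂ := betaJ c' D (j + 2) with hβbdef
  have hℓ2 : 2 ≤ ell D := by rw [ell]; linarith
  have hα0 : 0 < α := alpha_pos' (by linarith)
  have hη0 : 0 < η := lt_of_lt_of_le hα0 hαη
  have hαℓ : α * ell D ≤ 1 := alpha_mul_ell_le_one hℓ2
  have hα1 : α ≤ 1 := by
    have h1 : 1 ≤ ell D := by linarith
    nlinarith
  have hβμre : βμ.re = 0 := betaMu_re D μ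
  have hβare : βa.re = 0 := betaJ_re c' D _
  have hβbre : βb.re = 0 := betaJ_re c' D _
  obtain ⟨hβμ1, hβμ2⟩ := betaMu_im_bounds D μ hα0.le
  rw [← hβμdef, ← hαdef] at hβμ1 hβμ2
  have hβμn : ‖βμ‖ ≤ 1 / 2 := by
    rw [norm_betaMu D μ hα0.le, ← hβμdef]
    have : η ≤ 1 / 40 := hη40
    nlinarith
  have hβn : ∀ i : ℕ, ‖betaJ c' D i‖ ≤ 1 := by
    intro i
    have h := norm_betaJ_le c' D i hα0.le (by linarith : 0 ≤ ell D)
    refine h.trans ?_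
    have h1 : 5 * |c'| * alpha D * ell D ≤ 5 * |c'| := by
      calc 5 * |c'| * alpha D * ell D = 5 * |c'| * (alpha D * ell D) := by ring
        _ ≤ 5 * |c'| * 1 := by gcongr
        _ = 5 * |c'| := mul_one _
    -- `3α(1 + 5|c′|) ≤ 3Kα/ ... ≤ 1` via `Kα ≤ Kπ/𝓛⁹ ≤ 1/𝓛 ≤ 1`
    have hKα : K * α ≤ 1 := by
      rw [hαdef, alpha_eq]
      have h9 : Real.log D ^ 9 = Real.log D ^ 8 * Real.log D := by ring
      rw [mul_div_assoc', div_le_one (by positivity), h9]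
      calc K * π ≤ Real.log D ^ 8 := hKL
        _ = Real.log D ^ 8 * 1 := (mul_one _).symm
        _ ≤ Real.log D ^ 8 * Real.log D := by gcongr; linarith
    rw [← hαdef] at h1 ⊢
    nlinarith [abs_nonneg c']
  -- the integrand
  set Φ : ℂ → ℂ := fun u => U (1 - βμ + u) * χ.LFunction (1 - βμ + u + βa) *
    χ.LFunction (1 - βμ + u + βb) / χ.LFunction (1 - βμ + u) with hΦdef
  have hΦ : ∀ u, Φ u = U (1 - βμ + u) * χ.LFunction (1 - βμ + u + βa) *
      χ.LFunction (1 - βμ + u + βb) / χ.LFunction (1 - βμ + u) := fun u => rfl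
  set f : ℕ → ℂ := fun n => χ (n : ZMod D) * xiZero c' D j n d r * (n : ℂ) ^ (βμ - 1) with hfdef
  -- sizes of `y`
  have hT1 : 1 < bigT D := by rw [bigT]; exact Real.one_lt_exp_iff.2 (by positivity)
  have hy0 : 0 < y := by linarith
  have hy1' : 1 ≤ y := by linarith
  -- the three `Φ`-bounds
  have hPhiR : ∀ u : ℂ, α ≤ u.re → χ.LFunction (1 - βμ + u) ≠ 0 ∧
      ‖Φ u‖ ≤ MU * ((1 + α) / α) ^ 3 := fun u hu =>
    norm_Phi_right_le χ U Φ βμ βa βb hα0 hβμre hβare hβbre hΦ hMU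
      (fun w hw => hU w (by linarith)) hu
  have hPhiL : ∀ t : ℝ, |t| ≤ (D : ℝ) → ‖Φ (((-η : ℝ) : ℂ) + t * I)‖ ≤
      MU * BL * BL * (Minv * (1 + 2 / η)) := fun t ht =>
    norm_Phi_left_le χ U Φ βμ βa βb hη0 (by linarith) hβμre hβμn hβare (hβn _) hβbre (hβn _)
      hΦ hMU hU hBL hL hMinv hpack hρη ht
  have hD2 : (2 : ℝ) ≤ D := by
    have h3 : Real.exp 3 ≤ D := by
      have hD0 : (0 : ℝ) < D := by
        rcases lt_or_ge 0 (D : ℝ) with h | h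
        · exact h
        · have : Real.log (D : ℝ) ≤ 0 := by
            have : (D : ℝ) = 0 := le_antisymm h (Nat.cast_nonneg D)
            rw [this, Real.log_zero]
          linarith
      exact (Real.le_log_iff_exp_le hD0).1 h𝓛
    have : (2 : ℝ) ≤ Real.exp 3 := by
      have := Real.add_one_le_exp (3 : ℝ); linarith
    linarith
  have hPhiH : ∀ x' y' : ℝ, -η ≤ x' → x' ≤ α → |y'| = (D : ℝ) →
      ‖Φ ((x' : ℂ) + y' * I)‖ ≤ MU * BL * BL * (Minv * 3) := fun x' y' h1 h2 h3 =>
    norm_Phi_horiz_le χ U Φ βμ βa βb hη0 (by linarith) hα1 hD2 hβμre hβμn hβare (hβn _)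
      hβbre (hβn _) hΦ hMU hU hBL hL hMinv hpack h1 h2 h3
  -- the zero-free box (strict form)
  have hzf : ∀ w : ℂ, 1 - 2 * η < w.re → |w.im| < (D : ℝ) + 1 → w ≠ ρ →
      χ.LFunction w ≠ 0 := fun w h1 h2 h3 => (hpack w h1.le h2.le h3).1
  -- the Dirichlet series
  have hf9 : LSeriesSummable f 9 :=
    LSeriesSummable_coeff c' χ j μ d r (u := 9) (by rw [Complex.re_ofNat]; norm_num)
  have hfΦ : ∀ t : ℝ, LSeries f ((9 : ℝ) + t * I) = Φ ((9 : ℝ) + t * I) := by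
    intro t
    have h9 : (8 : ℝ) < (((9 : ℝ) : ℂ) + t * I).re := by simp; norm_num
    rw [LSeries_coeff_eq_xiSeries c' χ j μ d r h9, hΦ]
    set w : ℂ := 1 - βμ + (((9 : ℝ) : ℂ) + t * I) with hw
    have hwre : w.re = 10 := by simp [hw, hβμre]; norm_num
    have hw1 : 1 < w.re := by rw [hwre]; norm_num
    have hne : ∀ β : ℂ, β.re = 0 → χ.LFunction (w + β) ≠ 0 := fun β hβ =>
      (inv_LFunction_le_right χ (a := 9) (by norm_num) (s := w + β)
        (by simp [hwre, hβ]; norm_num)).1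
    have hne0 : χ.LFunction w ≠ 0 := by
      have := hne 0 (by simp); rwa [add_zero] at this
    have hna := hne βa hβare
    have hnb := hne βb hβbre
    rw [hU1 w hw1]
    field_simp
  -- apply the generic contour bound
  have hmain := norm_sum_log_sub_main_le χ U Φ f (deriv χ.LFunction 1 * PiW χ d r) βμ βa βb
    (x := y) (ρ := ρ) (η := η) (α := α) (T' := (D : ℝ)) hχ1 hUd hβμre hβμ1 hβμ2 hΦ hy1' hα0 hαη
    hη40 (by linarith) hρ1 hρα hLρ hL'ρ hzf hf9 hfΦ (by positivity) hPhiR (by positivity) hPhiL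
    (by positivity) hPhiH
    (fun u hre him hbd => norm_Phi_sub_model_le χ c' hprim h𝓛 hA j μ hd hr U hC₈₃ hK hKL hℓ₀ hℓ
      hE hU3 hre him hbd)
  -- the printed sum is `e^{−β_μL}` times the Riesz mean
  have hsum := printedSum_eq c' χ j μ d r hy0
  have hmainterm : deriv χ.LFunction 1 * PiW χ d r * frakgW c' D j μ y =
      cexp (-(βμ * (Real.log y : ℂ))) * (deriv χ.LFunction 1 * PiW χ d r *
        cexp (βμ * (Real.log y : ℂ)) * frakg βa βb βμ (Real.log y : ℂ)) := by
    rw [frakgW, ← hβadef, ← hβbdef, ← hβμdef]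
    have : cexp (-(βμ * (Real.log y : ℂ))) * cexp (βμ * (Real.log y : ℂ)) = 1 := by
      rw [← Complex.exp_add, neg_add_cancel, Complex.exp_zero]
    calc deriv χ.LFunction 1 * PiW χ d r * frakg βa βb βμ (Real.log y : ℂ)
        = (cexp (-(βμ * (Real.log y : ℂ))) * cexp (βμ * (Real.log y : ℂ))) *
            (deriv χ.LFunction 1 * PiW χ d r * frakg βa βb βμ (Real.log y : ℂ)) := by
          rw [this, one_mul]
      _ = _ := by ring
  rw [hsum, hmainterm, ← mul_sub, norm_mul, norm_cexp_neg_betaMu_mul, one_mul]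
  exact hmain

end Estimate

end Literature.NumberTheory.LFunctions.Zhang2022.Lemma84
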